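import Summits.Ventures.Crystal3D.Theorems.StickyWulffConstantCoaxialWallLawHaggConst
import Summits.Ventures.Crystal3D.Theorems.StickyWulffConstantGenericWallFloorCoaxialCriterion
import Mathlib.Analysis.InnerProductSpace.Projection.Reflection
import HarnessLib

/-!
# A co-axial grain with the twin word: the frame is the shared frame composed with the half-turn

HONEST FRAMING. Part of the venture `Summits/Ventures/Crystal3D` (cell `crystal3d-full`), helper
`--supports` the crux `CoaxialWallLaw` (stmt-Ventures-19481, `route-Ventures-StickyWulffConstant`),
REGISTERED line `WallLedgerF` (planner cf-p1 gen 16), stub `stub_coaxialTwoSlabAdhesion`.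
Completes the frame normalisation of `…CoaxialWallLawHaggConst`: there the Hägg sequence `σ` of a
co-axial frame `(L, s, σ)` of a grain `A·Λ₀ + t` was shown constant and the case `σ ≡ 1` gave
`A·Λ₀ + t = L·Λ₀ + s`.  Here the case `σ ≡ −1` (the TWIN word `…ACBACB…`):

(uses `haggLabel_negConst` of `…GenericWallFloorCoaxialCriterion`, seat wulff-p2: `L k = −k`)
* `halfTurn_apply` — the reflection of `ℝ³` in the line `ℝ e₃` (Mathlib's
  `(ℝ ∙ e₃).reflection`, a linear isometry) is the half-turn `(x, y, z) ↦ (−x, −y, z)`; it fixes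
  `e₃` (`halfTurn_e₃`);
* `barlowStacking_negConst_eq_halfTurn_image` — the `−1` stacking is the half-turn image of the
  model lattice `Λ₀` (site `(k, i, j) ↦ (k, −i, −j)`);
* `coaxial_frame_eq_fcc_of_neg_one` — hence, under the crux's hypothesis with `σ 0 = −1`,
  `A·Λ₀ + t = (R.trans L)·Λ₀ + s` with `(R.trans L) e₃ = L e₃`: the grain is again a moved model
  lattice whose basal axis is the SHARED axis, so `inPlane_vacancies_ge_sine`
  (`…CoaxialWallLawInPlaneCount`) applies to BOTH grains of a co-axial pair with the crux's sine
  `√(1 − ⟪L e₃, e₃⟫²)`.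

WHAT THIS IS NOT: any deficiency estimate; the stub; rung F-C1 not moved.
-/

noncomputable section

namespace Summit.Ventures.Crystal3D.Theorems

open Summit.Ventures.Crystal3D
open Literature.MathematicalPhysics.StatisticalMechanics (barlowPos barlowStacking fccStacking
  constHagg IsHaggSeq haggLabel haggLabel_succ haggLabel_zero haggLabel_const barlowPos_mem
  barlowPos_apply_zero barlowPos_apply_one barlowPos_apply_two)
open scoped InnerProductSpace

/-- **The half-turn about `e₃`.**  The reflection of `ℝ³` in the line `ℝ e₃` acts by
`(x, y, z) ↦ (−x, −y, z)`. -/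
theorem halfTurn_apply (p : EuclideanSpace ℝ (Fin 3)) :
    (ℝ ∙ EuclideanSpace.single (2 : Fin 3) (1 : ℝ)).reflection p =
      (2 * p 2) • EuclideanSpace.single (2 : Fin 3) (1 : ℝ) - p := by
  rw [Submodule.reflection_apply, Submodule.starProjection_singleton]
  have hn : ‖(EuclideanSpace.single (2 : Fin 3) (1 : ℝ))‖ = 1 := by
    rw [PiLp.norm_single, norm_one]
  rw [hn, EuclideanSpace.inner_single_left]
  simp only [map_one, one_mul, one_pow, div_one]
  rw [two_smul, ← add_smul]
  congr 1
  ring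

/-- Coordinates of the half-turn: `(−p₀, −p₁, p₂)`. -/
theorem halfTurn_coord (p : EuclideanSpace ℝ (Fin 3)) :
    (ℝ ∙ EuclideanSpace.single (2 : Fin 3) (1 : ℝ)).reflection p 0 = -p 0 ∧
      (ℝ ∙ EuclideanSpace.single (2 : Fin 3) (1 : ℝ)).reflection p 1 = -p 1 ∧
      (ℝ ∙ EuclideanSpace.single (2 : Fin 3) (1 : ℝ)).reflection p 2 = p 2 := by
  rw [halfTurn_apply]
  refine ⟨by simp, by simp, ?_⟩
  simp
  ring

/-- The half-turn fixes `e₃`. -/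
theorem halfTurn_e₃ :
    (ℝ ∙ EuclideanSpace.single (2 : Fin 3) (1 : ℝ)).reflection (EuclideanSpace.single (2 : Fin 3) (1 : ℝ)) =
      EuclideanSpace.single (2 : Fin 3) (1 : ℝ) := by
  obtain ⟨h0, h1, h2⟩ := halfTurn_coord (EuclideanSpace.single (2 : Fin 3) (1 : ℝ))
  ext l
  fin_cases l
  · simp only [Fin.zero_eta, Fin.isValue] at h0 ⊢
    rw [h0]; simp
  · simp only [Fin.mk_one, Fin.isValue] at h1 ⊢
    rw [h1]; simp
  · simp only [Fin.reduceFinMk, Fin.isValue] at h2 ⊢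
    rw [h2]

/-- **The twin word is the half-turn image of the model lattice.**
`barlowStacking 1 √(2/3) (fun _ => −1) = R '' Λ₀`, `R` the half-turn about `e₃`. -/
theorem barlowStacking_negConst_eq_halfTurn_image :
    barlowStacking 1 (Real.sqrt (2 / 3)) (fun _ => (-1 : ℤ)) =
      (ℝ ∙ EuclideanSpace.single (2 : Fin 3) (1 : ℝ)).reflection '' fccStacking 1 (Real.sqrt (2 / 3)) := by
  -- the half-turn of the site `(k, i, j)` of `Λ₀` is the site `(k, −i, −j)` of the `−1` stacking
  have key : ∀ k i j : ℤ,
      (ℝ ∙ EuclideanSpace.single (2 : Fin 3) (1 : ℝ)).reflection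
          (barlowPos 1 (Real.sqrt (2 / 3)) constHagg k i j) =
        barlowPos 1 (Real.sqrt (2 / 3)) (fun _ => (-1 : ℤ)) k (-i) (-j) := by
    intro k i j
    obtain ⟨h0, h1, h2⟩ := halfTurn_coord (barlowPos 1 (Real.sqrt (2 / 3)) constHagg k i j)
    ext l
    fin_cases l
    · simp only [Fin.zero_eta, Fin.isValue] at h0 ⊢
      rw [h0, barlowPos_apply_zero, barlowPos_apply_zero, haggLabel_const, haggLabel_negConst]
      push_cast; ring
    · simp only [Fin.mk_one, Fin.isValue] at h1 ⊢
      rw [h1, barlowPos_apply_one, barlowPos_apply_one, haggLabel_const, haggLabel_negConst]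
      push_cast; ring
    · simp only [Fin.reduceFinMk, Fin.isValue] at h2 ⊢
      rw [h2, barlowPos_apply_two, barlowPos_apply_two]
  ext x
  constructor
  · rintro ⟨k, i, j, rfl⟩
    refine ⟨barlowPos 1 (Real.sqrt (2 / 3)) constHagg k (-i) (-j), barlowPos_mem _ _ _, ?_⟩
    rw [key, neg_neg, neg_neg]
  · rintro ⟨p, ⟨k, i, j, rfl⟩, rfl⟩
    exact ⟨k, -i, -j, key k i j⟩

/-- **Frame normalisation, twin word.**  Under the crux's co-axiality hypothesis for the grain
`A·Λ₀ + t` with frame `(L, s, σ)` and `σ 0 = −1`: the grain is the moved model lattice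
`(R.trans L)·Λ₀ + s` (`R` the half-turn about `e₃`), and `(R.trans L) e₃ = L e₃`. -/
theorem coaxial_frame_eq_fcc_of_neg_one
    (A : EuclideanSpace ℝ (Fin 3) ≃ₗᵢ[ℝ] EuclideanSpace ℝ (Fin 3)) (t : EuclideanSpace ℝ (Fin 3))
    (L : EuclideanSpace ℝ (Fin 3) ≃ₗᵢ[ℝ] EuclideanSpace ℝ (Fin 3)) (s : EuclideanSpace ℝ (Fin 3))
    {σ : ℤ → ℤ} (hσ : IsHaggSeq σ)
    (hsub : (fun p => A p + t) '' fccStacking 1 (Real.sqrt (2 / 3)) ⊆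
      (fun p => L p + s) '' barlowStacking 1 (Real.sqrt (2 / 3)) σ)
    (h0 : σ 0 = -1) :
    (fun p => A p + t) '' fccStacking 1 (Real.sqrt (2 / 3)) =
      (fun p => ((ℝ ∙ EuclideanSpace.single (2 : Fin 3) (1 : ℝ)).reflection.trans L) p + s) ''
        fccStacking 1 (Real.sqrt (2 / 3)) ∧
    ((ℝ ∙ EuclideanSpace.single (2 : Fin 3) (1 : ℝ)).reflection.trans L)
        (EuclideanSpace.single (2 : Fin 3) (1 : ℝ)) = L (EuclideanSpace.single (2 : Fin 3) (1 : ℝ)) := by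
  have hconst : σ = fun _ => (-1 : ℤ) := by
    funext k
    rw [coaxial_hagg_const A t L s hσ hsub k, h0]
  constructor
  · rw [movedFcc_eq_barlowImage A t L s hσ hsub, hconst, barlowStacking_negConst_eq_halfTurn_image,
      Set.image_image]
    rfl
  · rw [LinearIsometryEquiv.trans_apply, halfTurn_e₃]

end Summit.Ventures.Crystal3D.Theorems

end
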